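import Literature.NumberTheory.LFunctions.MertensPrimeIdeals
import HarnessLib

/-!
# Mertens' second theorem for the prime ideals of a number field WITH ITS CONSTANT:
# `∑_{N𝔭 ≤ x} 1/N𝔭 = log log x + M_K + O_K(1/log² x)` (Landau 1903; Rosen 1999, Thm 2 / Lemma 2.3)

Topic `Literature/NumberTheory/LFunctions` (next to `MertensPrimeIdeals.lean`, which has the `O_K(1)` forms
without the constant, and `DegreeOnePrimesPNT.lean`, which has the degree-one form with rate).  Everything in
this file is PROVED (theorems only, no named facts); it is a reproduction with citation of

* M. Rosen, *A generalization of Mertens' theorem*, J. Ramanujan Math. Soc. 14 (1999), 1–19: for a number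
  field `K`, `∑_{N𝔭 ≤ x} 1/N𝔭 = log log x + M_K + O_K(1/log x)` and
  `∏_{N𝔭 ≤ x} (1 − 1/N𝔭)^{-1} = e^{γ} κ_K log x (1 + O_K(1/log x))` (Theorem 2; the constant `M_K` is
  `γ + log κ_K + ∑_𝔭 [log(1 − 1/N𝔭) + 1/N𝔭]`, identified in the sequel `MertensNumberFieldResidue.lean`);

with the method of G. H. Hardy, E. M. Wright, *An Introduction to the Theory of Numbers*, §22.7
(partial summation against `1/(t log t)`), transposed from `ϑ` to `θ_K`:

* `ThetaMertens.abs_sum_div_mul_log_sub_loglog_le_explicit` — the partial summation WITH THE CONSTANT KEPT: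
  if `c : ℕ → ℝ` vanishes at `0, 1` and `|∑_{n ≤ t} c(n) − t| ≤ C t/log² t` for all `t ≥ 2`, then there is
  `m` with `|∑_{n ≤ x} c(n)/(n log n) − (log log x + m)| ≤ 4C/log² x` for all `x ≥ 2` (the tree's
  `ThetaMertens.sum_primesLE_div_of_theta` hides the dependence on `C`, which uniform versions need);
* `NumberField.sum_inv_absNorm_eq_sum` — bookkeeping: `∑_{N𝔭 ≤ x} 1/N𝔭 = ∑_{m ≤ x} G(m) log m/(m log m)`
  (`G(0) = G(1) = 0`, tree `normPrimeIdealCount_zero/one`);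
* `NumberField.exists_mertensConstant` — **for every number field `K` there are `M_K` and `C_K` with
  `|∑_{N𝔭 ≤ x} 1/N𝔭 − (log log x + M_K)| ≤ C_K/log² x` for all `x ≥ 2`** (Rosen's Lemma 2.3 / Thm 2 in the
  `1/N𝔭` form, from the tree's prime ideal theorem `abs_chebyshevThetaIdeal_sub_self_le_logPow`);
* `NumberField.tendsto_sum_inv_absNorm_sub_loglog` — the `o(1)` form `∑_{N𝔭 ≤ x} 1/N𝔭 − log log x − M_K → 0`.

## References

* M. Rosen, *A generalization of Mertens' theorem*, J. Ramanujan Math. Soc. 14 (1999) 1–19, Lemma 2.3, Thm 2.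
  [Rosen1999Mertens]
* E. Landau, *Neuer Beweis des Primzahlsatzes und Beweis des Primidealsatzes*, Math. Ann. 56 (1903), §15.
  [LandauMathAnn1903]
* G. H. Hardy, E. M. Wright, *An Introduction to the Theory of Numbers*, 6th ed., OUP 2008, §22.7–22.8,
  Theorems 427–428. [HardyWright2008]

## Mathlib / tree search

Tree: `MertensPrimeIdeals` (`sum_primeIdealsLE_eq_sum_normPrimeIdealCount`, `abs_chebyshevThetaIdeal_sub_self_le_logPow`,
`ThetaMertens.measurable_comp_natFloor`, `ThetaMertens.integral_Ioc_inv_div_log_add` via `DegreeOnePrimesPNT`),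
`MertensConstant` / `MertensSecondLogPower` (`Mertens.integrableOn_inv_div_log_pow`, `Mertens.integral_Ioi_inv_div_log_pow`),
`DegreeOnePrimesPNT` (`normPrimeIdealCount_eq_zero_of_not_isPrimePow`).  Mathlib: `sum_mul_eq_sub_sub_integral_mul`.
-/

noncomputable section

open Finset Real MeasureTheory Filter Set Topology
open scoped NumberField

namespace Literature.NumberTheory.LFunctions.ThetaMertens

/-! ### Partial summation with an explicit constant -/

set_option maxHeartbeats 800000 in
/-- **Mertens-type asymptotics from a Chebyshev estimate, with the constant kept** (partial summation with
`f(t) = 1/(t log t)`): if `c : ℕ → ℝ` vanishes at `0` and `1` and `|∑_{n ≤ t} c(n) − t| ≤ C t/(log t)²` for all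
`t ≥ 2`, then there is `m` with `|∑_{n ≤ x} c(n)/(n log n) − (log log x + m)| ≤ 4C/(log x)²` for all `x ≥ 2`.
[cite: HardyWright2008, §22.7 (22.7.3)–(22.7.4)] -/
theorem abs_sum_div_mul_log_sub_loglog_le_explicit {c : ℕ → ℝ} (hc0 : c 0 = 0) (hc1 : c 1 = 0) {C : ℝ}
    (hS : ∀ t : ℝ, 2 ≤ t → |∑ n ∈ Finset.Icc 0 ⌊t⌋₊, c n - t| ≤ C * t / Real.log t ^ 2) :
    ∃ m : ℝ, ∀ x : ℝ, 2 ≤ x →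
      |∑ n ∈ Finset.Icc 0 ⌊x⌋₊, c n / (n * Real.log n) - (Real.log (Real.log x) + m)| ≤ 4 * C / Real.log x ^ 2 := by
  set θw : ℝ → ℝ := fun t => ∑ n ∈ Finset.Icc 0 ⌊t⌋₊, c n with hθw
  set E : ℝ → ℝ := fun t => θw t - t with hE
  set φ : ℝ → ℝ := fun t => (Real.log t + 1) / (t ^ 2 * Real.log t ^ 2) with hφ
  have hl2 : 0 < Real.log 2 := Real.log_pos one_lt_two
  have hl2' : (1 : ℝ) / 2 < Real.log 2 := by
    have := Real.log_two_gt_d9; linarith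
  have hEb : ∀ t : ℝ, 2 ≤ t → |E t| ≤ C * t / Real.log t ^ 2 := fun t ht => hS t ht
  have hC : 0 ≤ C := by
    have h := (abs_nonneg _).trans (hEb 2 le_rfl)
    have h2 : (0 : ℝ) < 2 / Real.log 2 ^ 2 := by positivity
    have : C * 2 / Real.log 2 ^ 2 = C * (2 / Real.log 2 ^ 2) := by ring
    rw [this] at h
    nlinarith
  set C₂ : ℝ := C * (1 + (Real.log 2)⁻¹) with hC₂
  have hC₂0 : 0 ≤ C₂ := by positivity
  have hdom : ∀ t : ℝ, 2 ≤ t → |φ t * E t| ≤ C₂ * (t⁻¹ / Real.log t ^ (1 + 2)) := by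
    intro t ht
    have ht0 : 0 < t := by linarith
    have hlt : Real.log 2 ≤ Real.log t := Real.log_le_log two_pos ht
    have hl : 0 < Real.log t := hl2.trans_le hlt
    have hφ0 : 0 ≤ φ t := by simp only [hφ]; positivity
    rw [abs_mul, abs_of_nonneg hφ0]
    calc φ t * |E t| ≤ φ t * (C * t / Real.log t ^ 2) :=
          mul_le_mul_of_nonneg_left (hEb t ht) hφ0
      _ = C * (t⁻¹ / Real.log t ^ (1 + 2)) * (1 + (Real.log t)⁻¹) := by
          simp only [hφ]
          field_simp
          ring
      _ ≤ C * (t⁻¹ / Real.log t ^ (1 + 2)) * (1 + (Real.log 2)⁻¹) := by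
          refine mul_le_mul_of_nonneg_left ?_ (by positivity)
          gcongr
      _ = C₂ * (t⁻¹ / Real.log t ^ (1 + 2)) := by rw [hC₂]; ring
  have hEmeas : Measurable E :=
    (ThetaMertens.measurable_comp_natFloor (fun m => ∑ n ∈ Finset.Icc 0 m, c n)).sub measurable_id
  have hφmeas : Measurable φ :=
    ((Real.measurable_log.add_const 1).div ((measurable_id.pow_const 2).mul
      (Real.measurable_log.pow_const 2)))
  have hint : IntegrableOn (fun t => φ t * E t) (Set.Ioi 2) := by
    refine Integrable.mono' ((Mertens.integrableOn_inv_div_log_pow one_lt_two 1).const_mul C₂)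
      (hφmeas.mul hEmeas).aestronglyMeasurable ?_
    rw [ae_restrict_iff' measurableSet_Ioi]
    exact Eventually.of_forall fun t ht => by
      rw [Real.norm_eq_abs]; exact hdom t (le_of_lt ht)
  set I : ℝ := ∫ t in Set.Ioi 2, φ t * E t with hI
  set m : ℝ := c 2 / (2 * Real.log 2) - (2 * Real.log 2)⁻¹ * θw 2 +
    ((Real.log 2)⁻¹ - Real.log (Real.log 2)) + I with hm
  refine ⟨m, fun x hx => ?_⟩
  have hx0 : 0 < x := by linarith
  have hlx : 0 < Real.log x := Real.log_pos (by linarith)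
  have hl2x : Real.log 2 ≤ Real.log x := Real.log_le_log two_pos hx
  -- Abel summation with `f(t) = 1/(t log t)`
  set f : ℝ → ℝ := fun t => (t * Real.log t)⁻¹ with hf
  have hderiv : ∀ t : ℝ, 1 < t → HasDerivAt f (-φ t) t := by
    intro t ht
    have ht0 : t ≠ 0 := by linarith
    have hl : Real.log t ≠ 0 := (Real.log_pos ht).ne'
    have h1 : HasDerivAt (fun t : ℝ => t * Real.log t) (1 * Real.log t + t * t⁻¹) t :=
      (hasDerivAt_id t).mul (Real.hasDerivAt_log ht0)
    refine (h1.inv (mul_ne_zero ht0 hl)).congr_deriv ?_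
    simp only [hφ]
    field_simp
  have hf_diff : ∀ t ∈ Set.Icc 2 x, DifferentiableAt ℝ f t := fun t ht =>
    (hderiv t (by linarith [ht.1])).differentiableAt
  have hderiv_eq : Set.EqOn (fun t => -φ t) (deriv f) (Set.Icc 2 x) := fun t ht =>
    ((hderiv t (by linarith [ht.1])).deriv).symm
  have hφcont : ContinuousOn φ (Set.Icc 2 x) := by
    have hmem : ∀ t ∈ Set.Icc 2 x, t ∈ ({0}ᶜ : Set ℝ) := fun t ht =>
      Set.mem_compl_singleton_iff.mpr (show (0 : ℝ) < t by linarith [ht.1]).ne'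
    have hlogne : ∀ t ∈ Set.Icc 2 x, Real.log t ≠ 0 := fun t ht =>
      (Real.log_pos (by linarith [ht.1])).ne'
    refine ContinuousOn.div ((Real.continuousOn_log.mono hmem).add continuousOn_const)
      ((continuousOn_id.pow 2).mul ((Real.continuousOn_log.mono hmem).pow 2)) fun t ht => ?_
    exact mul_ne_zero (pow_ne_zero _ (by linarith [ht.1])) (pow_ne_zero _ (hlogne t ht))
  have hf_int : IntegrableOn (deriv f) (Set.Icc 2 x) :=
    (hφcont.neg.integrableOn_Icc).congr_fun hderiv_eq measurableSet_Icc
  have habel := sum_mul_eq_sub_sub_integral_mul c (by norm_num : (0 : ℝ) ≤ 2) hx hf_diff hf_int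
  have hfl2 : ⌊(2 : ℝ)⌋₊ = 2 := by norm_num
  have hfc : ∀ k : ℕ, f k * c k = c k / (k * Real.log k) := by
    intro k; simp only [hf]; rw [div_eq_mul_inv, mul_comm]
  have hx2 : 2 ≤ ⌊x⌋₊ := Nat.le_floor (by simpa using hx)
  have hsum : ∀ N : ℕ, ∑ k ∈ Finset.Icc 0 N, f k * c k = ∑ n ∈ Finset.Icc 0 N, c n / (n * Real.log n) :=
    fun N => Finset.sum_congr rfl fun k _ => hfc k
  have hlhs : ∑ k ∈ Finset.Ioc ⌊(2 : ℝ)⌋₊ ⌊x⌋₊, f k * c k =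
      ∑ n ∈ Finset.Icc 0 ⌊x⌋₊, c n / (n * Real.log n) - c 2 / (2 * Real.log 2) := by
    rw [hfl2, ← hsum, eq_sub_iff_add_eq]
    have hsplit : Finset.Icc 0 ⌊x⌋₊ = Finset.Icc 0 2 ∪ Finset.Ioc 2 ⌊x⌋₊ := by
      ext k; simp only [Finset.mem_union, Finset.mem_Icc, Finset.mem_Ioc]; omega
    have hdisj : Disjoint (Finset.Icc 0 2) (Finset.Ioc 2 ⌊x⌋₊) := by
      rw [Finset.disjoint_left]; intro k hk hk'
      simp only [Finset.mem_Icc, Finset.mem_Ioc] at hk hk'; omega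
    rw [hsplit, Finset.sum_union hdisj, add_comm]
    congr 1
    rw [show Finset.Icc 0 2 = {0, 1, 2} by decide]
    rw [Finset.sum_insert (by simp), Finset.sum_insert (by simp), Finset.sum_singleton, hfc, hfc, hfc,
      hc0, hc1]
    push_cast
    simp
  have hS : ∀ t : ℝ, ∑ k ∈ Finset.Icc 0 ⌊t⌋₊, c k = θw t := fun t => rfl
  have hb2 : f 2 * ∑ k ∈ Finset.Icc 0 ⌊(2 : ℝ)⌋₊, c k = (2 * Real.log 2)⁻¹ * θw 2 := by
    rw [hS]
  have hbx : f x * ∑ k ∈ Finset.Icc 0 ⌊x⌋₊, c k = 1 / Real.log x + f x * E x := by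
    rw [hS, hE, hf]
    simp only
    field_simp
    ring
  -- the integral term
  have hIoc_int : IntegrableOn (fun t => φ t * E t) (Set.Ioc 2 x) := hint.mono_set Set.Ioc_subset_Ioi_self
  have hmain_int : IntegrableOn (fun t : ℝ => t⁻¹ / Real.log t + t⁻¹ / Real.log t ^ 2) (Set.Ioc 2 x) :=
    ((Mertens.continuousOn_inv_div_log x).add
      (Mertens.continuousOn_inv_div_log_pow x 2)).integrableOn_Icc.mono_set Set.Ioc_subset_Icc_self
  have hint_eq : ∫ t in Set.Ioc 2 x, deriv f t * ∑ k ∈ Finset.Icc 0 ⌊t⌋₊, c k =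
      -(((Real.log (Real.log x) - (Real.log x)⁻¹) -
          (Real.log (Real.log 2) - (Real.log 2)⁻¹)) + ∫ t in Set.Ioc 2 x, φ t * E t) := by
    have h1 : ∫ t in Set.Ioc 2 x, deriv f t * ∑ k ∈ Finset.Icc 0 ⌊t⌋₊, c k =
        ∫ t in Set.Ioc 2 x, -((t⁻¹ / Real.log t + t⁻¹ / Real.log t ^ 2) + φ t * E t) := by
      refine setIntegral_congr_fun measurableSet_Ioc fun t ht => ?_
      rw [← hderiv_eq (Set.Ioc_subset_Icc_self ht), hS]
      have ht0 : (t : ℝ) ≠ 0 := by linarith [ht.1]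
      have hl : Real.log t ≠ 0 := (Real.log_pos (by linarith [ht.1])).ne'
      simp only [hE, hφ]
      field_simp
      ring
    rw [h1, integral_neg, integral_add hmain_int hIoc_int,
      ThetaMertens.integral_Ioc_inv_div_log_add hx]
  -- splitting `∫_2^x φ E = I - ∫_x^∞ φ E`
  have hsplit : ∫ t in Set.Ioc 2 x, φ t * E t = I - ∫ t in Set.Ioi x, φ t * E t := by
    rw [hI, ← Set.Ioc_union_Ioi_eq_Ioi hx, setIntegral_union (Set.Ioc_disjoint_Ioi le_rfl)
      measurableSet_Ioi hIoc_int (hint.mono_set (Set.Ioi_subset_Ioi hx))]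
    ring
  -- the exact formula
  have hformula : ∑ n ∈ Finset.Icc 0 ⌊x⌋₊, c n / (n * Real.log n) - (Real.log (Real.log x) + m) =
      f x * E x - ∫ t in Set.Ioi x, φ t * E t := by
    rw [hlhs, hb2, hbx, hint_eq, hsplit] at habel
    rw [hm]
    have : (1 : ℝ) / Real.log x = (Real.log x)⁻¹ := one_div _
    rw [this] at habel
    linear_combination habel
  rw [hformula]
  -- bounds
  have h1 : |f x * E x| ≤ C / Real.log 2 / Real.log x ^ 2 := by
    have hf0 : 0 ≤ f x := by simp only [hf]; positivity
    rw [abs_mul, abs_of_nonneg hf0]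
    calc f x * |E x| ≤ f x * (C * x / Real.log x ^ 2) :=
          mul_le_mul_of_nonneg_left (hEb x hx) hf0
      _ = C / Real.log x / Real.log x ^ 2 := by
          simp only [hf]
          field_simp
      _ ≤ C / Real.log 2 / Real.log x ^ 2 := by
          gcongr
  have h2 : |∫ t in Set.Ioi x, φ t * E t| ≤ C₂ / 2 / Real.log x ^ 2 := by
    have hwint : IntegrableOn (fun t : ℝ => t⁻¹ / Real.log t ^ (1 + 2)) (Set.Ioi x) :=
      (Mertens.integrableOn_inv_div_log_pow one_lt_two 1).mono_set (Set.Ioi_subset_Ioi hx)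
    have hbound : ∀ᵐ t ∂(volume.restrict (Set.Ioi x)),
        ‖φ t * E t‖ ≤ C₂ * (t⁻¹ / Real.log t ^ (1 + 2)) := by
      rw [ae_restrict_iff' measurableSet_Ioi]
      refine Eventually.of_forall fun t ht => ?_
      rw [Real.norm_eq_abs]
      exact hdom t (hx.trans (le_of_lt ht))
    calc |∫ t in Set.Ioi x, φ t * E t| = ‖∫ t in Set.Ioi x, φ t * E t‖ := rfl
      _ ≤ ∫ t in Set.Ioi x, C₂ * (t⁻¹ / Real.log t ^ (1 + 2)) :=
          norm_integral_le_of_norm_le (hwint.const_mul C₂) hbound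
      _ = C₂ * ((((1 : ℕ) : ℝ) + 1) * Real.log x ^ (1 + 1))⁻¹ := by
          rw [integral_const_mul, Mertens.integral_Ioi_inv_div_log_pow (by linarith) 1]
      _ = C₂ / 2 / Real.log x ^ 2 := by
          push_cast
          rw [mul_inv, div_div, div_eq_mul_inv, mul_inv]; norm_num
  have hconst : C / Real.log 2 + C₂ / 2 ≤ 4 * C := by
    rw [hC₂]
    have hinv : (Real.log 2)⁻¹ ≤ 2 := by
      rw [inv_le_comm₀ hl2 (by norm_num)]; linarith
    have : C / Real.log 2 = C * (Real.log 2)⁻¹ := div_eq_mul_inv _ _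
    rw [this]
    nlinarith
  calc |f x * E x - ∫ t in Set.Ioi x, φ t * E t|
      ≤ |f x * E x| + |∫ t in Set.Ioi x, φ t * E t| := abs_sub _ _
    _ ≤ C / Real.log 2 / Real.log x ^ 2 + C₂ / 2 / Real.log x ^ 2 := add_le_add h1 h2
    _ = (C / Real.log 2 + C₂ / 2) / Real.log x ^ 2 := by ring
    _ ≤ 4 * C / Real.log x ^ 2 := by gcongr

end Literature.NumberTheory.LFunctions.ThetaMertens

namespace Literature.NumberTheory.LFunctions.NumberField

open Literature.NumberTheory.LFunctions.ThetaMertens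

variable (K : Type*) [Field K] [NumberField K]

/-! ### Bookkeeping -/

/-- `∑_{N𝔭 ≤ x} 1/N𝔭 = ∑_{m ≤ x} (G(m) log m)/(m log m)` (regrouping by the norm; the terms `m = 0, 1`
vanish on both sides). [cite: LandauMathAnn1903, p. 669 (G(n))] -/
theorem sum_inv_absNorm_eq_sum {x : ℝ} (hx : 0 ≤ x) :
    ∑ P ∈ (finite_primeIdealsLE K x).toFinset, (Ideal.absNorm P : ℝ)⁻¹ =
      ∑ m ∈ Finset.Icc 0 ⌊x⌋₊, (normPrimeIdealCount K m : ℝ) * Real.log m / (m * Real.log m) := by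
  rw [sum_primeIdealsLE_eq_sum_normPrimeIdealCount (f := fun n => (n : ℝ)⁻¹) hx]
  refine Finset.sum_congr rfl fun m _ ↦ ?_
  rcases Nat.lt_or_ge m 2 with hm | hm
  · interval_cases m
    · simp
    · simp
  · have hm0 : (m : ℝ) ≠ 0 := by positivity
    have hlog : Real.log m ≠ 0 := (Real.log_pos (by exact_mod_cast hm)).ne'
    field_simp

/-! ### Mertens' second theorem with its constant, for every number field -/

/-- **Mertens' second theorem for the prime ideals of a number field, with the constant** (Rosen 1999,
Lemma 2.3 / Theorem 2; Landau 1903): for every number field `K` there are `M_K` (Mertens' constant of `K`)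
and `C_K` with `|∑_{N𝔭 ≤ x} 1/N𝔭 − (log log x + M_K)| ≤ C_K/(log x)²` for all `x ≥ 2`.
[cite: Rosen1999Mertens, Lemma 2.3 and Theorem 2] -/
theorem exists_mertensConstant :
    ∃ M C : ℝ, ∀ x : ℝ, 2 ≤ x →
      |∑ P ∈ (finite_primeIdealsLE K x).toFinset, (Ideal.absNorm P : ℝ)⁻¹ - (Real.log (Real.log x) + M)| ≤
        C / Real.log x ^ 2 := by
  obtain ⟨C, hC⟩ := abs_chebyshevThetaIdeal_sub_self_le_logPow K 2
  set c : ℕ → ℝ := fun m ↦ (normPrimeIdealCount K m : ℝ) * Real.log m with hc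
  have hc0 : c 0 = 0 := by simp [hc]
  have hc1 : c 1 = 0 := by simp [hc]
  have hS : ∀ t : ℝ, 2 ≤ t → |∑ m ∈ Finset.Icc 0 ⌊t⌋₊, c m - t| ≤ C * t / Real.log t ^ 2 := by
    intro t ht
    have h := hC t ht
    rw [Real.rpow_two] at h
    exact h
  obtain ⟨M, hM⟩ := abs_sum_div_mul_log_sub_loglog_le_explicit hc0 hc1 hS
  refine ⟨M, 4 * C, fun x hx ↦ ?_⟩
  rw [sum_inv_absNorm_eq_sum K (by linarith)]
  have h := hM x hx
  simp only [hc] at h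
  exact h

/-- **Rosen's `o(1)` form**: a constant `M` with `|∑_{N𝔭 ≤ x} 1/N𝔭 − (log log x + M)| ≤ C/log² x` (`x ≥ 2`) satisfies
`∑_{N𝔭 ≤ x} 1/N𝔭 − log log x − M → 0` (`x → ∞`), i.e. `∑_{N𝔭 ≤ x} 1/N𝔭 = log log x + M_K + o(1)`.
[cite: Rosen1999Mertens, Lemma 2.3] -/
theorem tendsto_sum_inv_absNorm_sub_loglog {M C : ℝ}
    (h : ∀ x : ℝ, 2 ≤ x →
      |∑ P ∈ (finite_primeIdealsLE K x).toFinset, (Ideal.absNorm P : ℝ)⁻¹ - (Real.log (Real.log x) + M)| ≤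
        C / Real.log x ^ 2) :
    Tendsto (fun x : ℝ ↦ ∑ P ∈ (finite_primeIdealsLE K x).toFinset, (Ideal.absNorm P : ℝ)⁻¹ -
      (Real.log (Real.log x) + M)) atTop (𝓝 0) := by
  have hC : Tendsto (fun x : ℝ ↦ C / Real.log x ^ 2) atTop (𝓝 0) := by
    have h1 : Tendsto (fun x : ℝ ↦ Real.log x ^ 2) atTop atTop :=
      (tendsto_pow_atTop (by norm_num)).comp Real.tendsto_log_atTop
    simpa using h1.const_div_atTop C
  refine squeeze_zero_norm' ?_ hC
  filter_upwards [eventually_ge_atTop (2 : ℝ)] with x hx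
  rw [Real.norm_eq_abs]
  exact h x hx

end Literature.NumberTheory.LFunctions.NumberField

end
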